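import Summits.Ventures.PercRepro.Night2ShadowStep
import Summits.Ventures.PercRepro.MatroidTruncate
import Summits.Ventures.PercRepro.GenQBalance

/-!
# PercRepro — the diagonal shadow form from the selection conjecture: the wrapper (night-2, gen 5)

`Night2ShadowStep.lean` proves the inductive step for loopless matroids of rank `q + 2`.  This file supplies the
bookkeeping around it and assembles the induction:
* `shadowHall_of_Uq_empty`, `Uq_eq_empty_of_eRank_lt`: nothing to prove when there is no bottom set;
* truncation (`Matroid.truncate`, typer-2): `Uq M p q ⊆ Uq T p q`, `Yq T p q = Yq M p q`, the shadow is unchanged —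
  `shadowHall_of_truncate`;
* loops: a loop `ℓ` doubles the shadow and at most doubles the family — `shadowHall_of_delete_loop`;
* the base level `q = 0` on a loopless matroid of rank `2`: the bottom family is `{∅}` and two elements of a base are
  two rank-`1` sets — `shadowHall_two_zero`;
* **`shadowHall_diag_of_selection`**: `DirectHullSelection → ∀ q M, ShadowHall M (q + 2) q (phiK (q + 2) q)` by induction on
  `(q, #E)` — hence, with `c025_of_shadowHall`, **C-025 at every diagonal `(q + 2, q)` follows from `DirectHullSelection`**
  (`c025_diag_of_selection`).
-/

open scoped Matroid

namespace PercRepro.Shadow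

open Finset PerFlat ThmH

variable {α : Type} [DecidableEq α]

/-! ## No bottom sets -/

/-- The shadow condition is void when there is no bottom set. -/
theorem shadowHall_of_Uq_empty {M : Matroid α} [M.Finite] {p q : ℕ} {c : ℚ} (h : Uq M p q = ∅) :
    ShadowHall M p q c := by
  intro 𝒜 h𝒜
  rw [h, Finset.subset_empty] at h𝒜
  subst h𝒜
  simp

/-- A matroid of rank `< p` has no bottom set at `(p, q)`. -/
theorem Uq_eq_empty_of_eRank_lt {M : Matroid α} [M.Finite] {p q : ℕ} (h : M.eRank < (p : ℕ∞)) :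
    Uq M p q = ∅ := by
  rw [Finset.eq_empty_iff_forall_notMem]
  intro B hB
  rw [mem_Uq] at hB
  have h1 : M.eRk ((gr M \ B : Finset α) : Set α) ≤ M.eRank := M.eRk_le_eRank _
  rw [hB.2.2] at h1
  exact absurd (lt_of_le_of_lt h1 h) (lt_irrefl _)

/-! ## Truncation -/

omit [DecidableEq α] in
/-- The truncation has the ground finset of `M`. -/
theorem gr_truncate (M : Matroid α) [M.Finite] (p : ℕ) : gr (PercRepro.Matroid.truncate M p) = gr M := by
  apply Finset.coe_injective
  rw [coe_gr, coe_gr, PercRepro.Matroid.truncate_ground]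

/-- Bottom sets of `M` at `(p, q)` are bottom sets of the truncation to rank `p`. -/
theorem Uq_subset_truncate (M : Matroid α) [M.Finite] {p q : ℕ} (hqp : q < p) :
    Uq M p q ⊆ Uq (PercRepro.Matroid.truncate M p) p q := by
  intro B hB
  rw [mem_Uq] at hB ⊢
  rw [gr_truncate, PercRepro.Matroid.truncate_eRk, PercRepro.Matroid.truncate_eRk, hB.2.1, hB.2.2]
  refine ⟨hB.1, ?_, ?_⟩
  · exact min_eq_left (by exact_mod_cast hqp.le)
  · exact min_eq_left le_rfl

omit [DecidableEq α] in
/-- The middle level is unchanged by the truncation to rank `p`. -/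
theorem Yq_truncate (M : Matroid α) [M.Finite] (p q : ℕ) :
    Yq (PercRepro.Matroid.truncate M p) p q = Yq M p q := by
  ext S
  unfold Yq
  rw [Finset.mem_filter, Finset.mem_filter, gr_truncate, PercRepro.Matroid.truncate_eRk]
  constructor
  · rintro ⟨hS, h1, h2⟩
    refine ⟨hS, lt_of_lt_of_le h1 (min_le_left _ _), ?_⟩
    rcases le_or_gt (M.eRk (S : Set α)) (p : ℕ∞) with h | h
    · rwa [min_eq_left h] at h2
    · rw [min_eq_right h.le] at h2
      exact absurd h2 (lt_irrefl _)
  · rintro ⟨hS, h1, h2⟩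
    exact ⟨hS, by rw [min_eq_left h2.le]; exact h1, by rw [min_eq_left h2.le]; exact h2⟩

/-- The shadow of a family is unchanged by the truncation. -/
theorem shadow_truncate (M : Matroid α) [M.Finite] (p q : ℕ) (𝒜 : Finset (Finset α)) :
    shadow (PercRepro.Matroid.truncate M p) p q 𝒜 = shadow M p q 𝒜 := by
  ext S
  rw [mem_shadow, mem_shadow, Yq_truncate]

/-- The shadow condition descends from the truncation to rank `p`. -/
theorem shadowHall_of_truncate (M : Matroid α) [M.Finite] {p q : ℕ} (hqp : q < p) {c : ℚ}
    (h : ShadowHall (PercRepro.Matroid.truncate M p) p q c) : ShadowHall M p q c := by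
  intro 𝒜 h𝒜
  have := h 𝒜 (h𝒜.trans (Uq_subset_truncate M hqp))
  rwa [shadow_truncate] at this

omit [DecidableEq α] in
/-- The truncation of a loopless matroid to rank `p ≥ 1` is loopless. -/
theorem truncate_loopless (M : Matroid α) [M.Finite] {p : ℕ} (hp : 1 ≤ p) (hloop : ∀ e ∈ M.E, M.Indep {e}) :
    ∀ e ∈ (PercRepro.Matroid.truncate M p).E, (PercRepro.Matroid.truncate M p).Indep {e} := by
  intro e he
  rw [PercRepro.Matroid.truncate_ground] at he
  rw [PercRepro.Matroid.truncate_indep_iff]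
  exact ⟨hloop e he, by rw [Set.ncard_singleton]; exact hp⟩

/-! ## Loops -/

omit [DecidableEq α] in
/-- Adding a loop to a subset of the ground set does not change its rank. -/
theorem eRk_insert_loop {M : Matroid α} [M.Finite] {ℓ : α} (hℓ : ℓ ∈ M.E) (hl : ¬ M.Indep {ℓ}) {X : Set α}
    (hX : X ⊆ M.E) : M.eRk (insert ℓ X) = M.eRk X := by
  have hloop : M.IsLoop ℓ := Matroid.isLoop_of_not_isNonloop hℓ (fun h => hl (Matroid.indep_singleton.2 h))
  exact eRk_insert_eq_of_mem_closure hX (hloop.mem_closure X)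

/-- Removing a loop from a subset of the ground set does not change its rank. -/
theorem eRk_erase_loop {M : Matroid α} [M.Finite] {ℓ : α} (hℓ : ℓ ∈ M.E) (hl : ¬ M.Indep {ℓ}) {X : Finset α}
    (hX : X ⊆ gr M) : M.eRk ((X.erase ℓ : Finset α) : Set α) = M.eRk (X : Set α) := by
  by_cases h : ℓ ∈ X
  · have h1 : M.eRk (insert ℓ ((X.erase ℓ : Finset α) : Set α)) = M.eRk ((X.erase ℓ : Finset α) : Set α) :=
      eRk_insert_loop hℓ hl (by rw [← coe_gr]; exact_mod_cast (Finset.erase_subset ℓ X).trans hX)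
    rw [← h1, ← Finset.coe_insert, Finset.insert_erase h]
  · rw [Finset.erase_eq_of_notMem h]

/-- A family member with the loop removed is a bottom set of `M ＼ {ℓ}`. -/
theorem erase_mem_Uq_delete_loop {M : Matroid α} [M.Finite] {ℓ : α} (hℓ : ℓ ∈ M.E) (hl : ¬ M.Indep {ℓ}) {p q : ℕ}
    {B : Finset α} (hB : B ∈ Uq M p q) : B.erase ℓ ∈ Uq (M ＼ ({ℓ} : Set α)) p q := by
  rw [mem_Uq] at hB ⊢
  obtain ⟨hBg, hBq, hBc⟩ := hB
  have hX : ((B.erase ℓ : Finset α) : Set α) ⊆ M.E \ {ℓ} := by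
    rw [Finset.coe_erase]
    exact Set.sdiff_subset_sdiff_left (by rw [← coe_gr]; exact_mod_cast hBg)
  refine ⟨?_, ?_, ?_⟩
  · rw [gr_delete]; exact Finset.erase_subset_erase ℓ hBg
  · rw [delete_singleton_eRk_eq hX, eRk_erase_loop hℓ hl hBg, hBq]
  · rw [gr_delete, erase_sdiff_erase]
    have hX' : (((gr M \ B).erase ℓ : Finset α) : Set α) ⊆ M.E \ {ℓ} := by
      rw [Finset.coe_erase]
      exact Set.sdiff_subset_sdiff_left (by rw [← coe_gr]; exact_mod_cast Finset.sdiff_subset)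
    rw [delete_singleton_eRk_eq hX', eRk_erase_loop hℓ hl Finset.sdiff_subset, hBc]

/-- A middle-level set of `M ＼ {ℓ}` is a middle-level set of `M`, and so is the set with the loop added. -/
theorem mem_Yq_of_delete_loop {M : Matroid α} [M.Finite] {ℓ : α} (hℓ : ℓ ∈ M.E) (hl : ¬ M.Indep {ℓ}) {p q : ℕ}
    {S : Finset α} (hS : S ∈ Yq (M ＼ ({ℓ} : Set α)) p q) : ℓ ∉ S ∧ S ∈ Yq M p q ∧ insert ℓ S ∈ Yq M p q := by
  unfold Yq at hS ⊢
  rw [Finset.mem_filter, Finset.mem_powerset, gr_delete] at hS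
  obtain ⟨hSg, h1, h2⟩ := hS
  have hℓS : ℓ ∉ S := fun h => (Finset.mem_erase.1 (hSg h)).1 rfl
  have hSg' : S ⊆ gr M := hSg.trans (Finset.erase_subset _ _)
  have hX : ((S : Finset α) : Set α) ⊆ M.E \ {ℓ} := by
    rw [← coe_gr, ← Finset.coe_erase]; exact_mod_cast hSg
  rw [delete_singleton_eRk_eq hX] at h1 h2
  have hins : M.eRk ((insert ℓ S : Finset α) : Set α) = M.eRk (S : Set α) := by
    rw [Finset.coe_insert]
    exact eRk_insert_loop hℓ hl (by rw [← coe_gr]; exact_mod_cast hSg')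
  refine ⟨hℓS, ?_, ?_⟩
  · rw [Finset.mem_filter, Finset.mem_powerset]; exact ⟨hSg', h1, h2⟩
  · rw [Finset.mem_filter, Finset.mem_powerset, hins]
    exact ⟨Finset.insert_subset (by rw [← Finset.mem_coe, coe_gr]; exact hℓ) hSg', h1, h2⟩

/-- **Loops are harmless**: the shadow condition for `M ＼ {ℓ}` (`ℓ` a loop) gives it for `M`. -/
theorem shadowHall_of_delete_loop {M : Matroid α} [M.Finite] {ℓ : α} (hℓ : ℓ ∈ M.E) (hl : ¬ M.Indep {ℓ}) {p q : ℕ}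
    {c : ℚ} (hc : 0 ≤ c) (h : ShadowHall (M ＼ ({ℓ} : Set α)) p q c) : ShadowHall M p q c := by
  classical
  intro 𝒜 h𝒜
  -- the members with the loop removed, and the members avoiding the loop
  set 𝒜' : Finset (Finset α) := 𝒜.image (fun B => B.erase ℓ) with h𝒜'
  set 𝒜₀ : Finset (Finset α) := 𝒜.filter (fun B => ℓ ∉ B) with h𝒜₀
  have h𝒜'U : 𝒜' ⊆ Uq (M ＼ ({ℓ} : Set α)) p q := by
    intro B' hB'
    rw [h𝒜', Finset.mem_image] at hB'
    obtain ⟨B, hB, rfl⟩ := hB'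
    exact erase_mem_Uq_delete_loop hℓ hl (h𝒜 hB)
  have h𝒜₀U : 𝒜₀ ⊆ Uq (M ＼ ({ℓ} : Set α)) p q := by
    intro B hB
    rw [h𝒜₀, Finset.mem_filter] at hB
    have := erase_mem_Uq_delete_loop hℓ hl (h𝒜 hB.1)
    rwa [Finset.erase_eq_of_notMem hB.2] at this
  -- #𝒜 ≤ #𝒜' + #𝒜₀
  have hcount : 𝒜.card ≤ 𝒜'.card + 𝒜₀.card := by
    have h1 : (𝒜 \ 𝒜₀).card ≤ 𝒜'.card := by
      apply Finset.card_le_card_of_injOn (fun B => B.erase ℓ)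
      · intro B hB
        rw [Finset.coe_sdiff] at hB
        exact Finset.mem_image_of_mem _ hB.1
      · intro B₁ hB₁ B₂ hB₂ h12
        rw [Finset.coe_sdiff] at hB₁ hB₂
        have e₁ : ℓ ∈ B₁ := by
          by_contra hne
          exact hB₁.2 (by rw [Finset.mem_coe, h𝒜₀, Finset.mem_filter]; exact ⟨hB₁.1, hne⟩)
        have e₂ : ℓ ∈ B₂ := by
          by_contra hne
          exact hB₂.2 (by rw [Finset.mem_coe, h𝒜₀, Finset.mem_filter]; exact ⟨hB₂.1, hne⟩)
        have h12' : B₁.erase ℓ = B₂.erase ℓ := h12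
        rw [← Finset.insert_erase e₁, ← Finset.insert_erase e₂, h12']
    have h2 : 𝒜.card = (𝒜 \ 𝒜₀).card + 𝒜₀.card := by
      rw [Finset.card_sdiff_add_card_eq_card (Finset.filter_subset _ _)]
    omega
  -- the two halves of the shadow
  set S1 : Finset (Finset α) := (shadow (M ＼ ({ℓ} : Set α)) p q 𝒜').image (fun S => insert ℓ S) with hS1
  have hS1card : S1.card = (shadow (M ＼ ({ℓ} : Set α)) p q 𝒜').card := by
    apply Finset.card_image_of_injOn
    intro S hS S' hS' hSS'
    have h1 : ℓ ∉ S := (mem_Yq_of_delete_loop hℓ hl (mem_shadow.1 hS).1).1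
    have h2 : ℓ ∉ S' := (mem_Yq_of_delete_loop hℓ hl (mem_shadow.1 hS').1).1
    have hSS'' : insert ℓ S = insert ℓ S' := hSS'
    calc S = (insert ℓ S).erase ℓ := (Finset.erase_insert h1).symm
      _ = (insert ℓ S').erase ℓ := by rw [hSS'']
      _ = S' := Finset.erase_insert h2
  have hS1sub : S1 ⊆ shadow M p q 𝒜 := by
    intro S hS
    rw [hS1, Finset.mem_image] at hS
    obtain ⟨S', hS', rfl⟩ := hS
    rw [mem_shadow] at hS' ⊢
    obtain ⟨hY, B', hB', hB'S⟩ := hS'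
    refine ⟨(mem_Yq_of_delete_loop hℓ hl hY).2.2, ?_⟩
    rw [h𝒜', Finset.mem_image] at hB'
    obtain ⟨B, hB, rfl⟩ := hB'
    exact ⟨B, hB, (Finset.insert_erase_subset ℓ B).trans (Finset.insert_subset_insert ℓ hB'S)⟩
  have hS1ℓ : ∀ S ∈ S1, ℓ ∈ S := by
    intro S hS
    rw [hS1, Finset.mem_image] at hS
    obtain ⟨S', -, rfl⟩ := hS
    exact Finset.mem_insert_self _ _
  set S0 : Finset (Finset α) := shadow (M ＼ ({ℓ} : Set α)) p q 𝒜₀ with hS0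
  have hS0sub : S0 ⊆ shadow M p q 𝒜 := by
    intro S hS
    rw [hS0, mem_shadow] at hS
    obtain ⟨hY, B, hB, hBS⟩ := hS
    rw [mem_shadow]
    exact ⟨(mem_Yq_of_delete_loop hℓ hl hY).2.1, B, (Finset.filter_subset _ _) hB, hBS⟩
  have hS0ℓ : ∀ S ∈ S0, ℓ ∉ S := by
    intro S hS
    rw [hS0, mem_shadow] at hS
    exact (mem_Yq_of_delete_loop hℓ hl hS.1).1
  have hdisj : Disjoint S1 S0 := by
    rw [Finset.disjoint_left]
    intro S h1 h0
    exact hS0ℓ S h0 (hS1ℓ S h1)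
  have hunion : (S1 ∪ S0).card ≤ (shadow M p q 𝒜).card :=
    Finset.card_le_card (Finset.union_subset hS1sub hS0sub)
  rw [Finset.card_union_of_disjoint hdisj, hS1card] at hunion
  have hIH1 := h 𝒜' h𝒜'U
  have hIH0 := h 𝒜₀ h𝒜₀U
  have hcount' : (𝒜.card : ℚ) ≤ (𝒜'.card : ℚ) + (𝒜₀.card : ℚ) := by exact_mod_cast hcount
  have hunion' : ((shadow (M ＼ ({ℓ} : Set α)) p q 𝒜').card : ℚ) + (S0.card : ℚ) ≤ ((shadow M p q 𝒜).card : ℚ) := by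
    exact_mod_cast hunion
  calc c * (𝒜.card : ℚ) ≤ c * ((𝒜'.card : ℚ) + (𝒜₀.card : ℚ)) := mul_le_mul_of_nonneg_left hcount' hc
    _ = c * (𝒜'.card : ℚ) + c * (𝒜₀.card : ℚ) := by ring
    _ ≤ ((shadow (M ＼ ({ℓ} : Set α)) p q 𝒜').card : ℚ) + (S0.card : ℚ) := add_le_add hIH1 hIH0
    _ ≤ ((shadow M p q 𝒜).card : ℚ) := hunion'

/-! ## The base level `q = 0` -/

/-- On a loopless matroid of rank `2` the shadow condition at `(2, 0)` holds with the constant `Φ(2, 0) = 2`. -/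
theorem shadowHall_two_zero {M : Matroid α} [M.Finite] (hloop : ∀ e ∈ M.E, M.Indep {e})
    (hM : M.eRank = ((2 : ℕ) : ℕ∞)) : ShadowHall M 2 0 (phiK 2 0) := by
  classical
  intro 𝒜 h𝒜
  -- every bottom set is empty
  have hU : ∀ B ∈ 𝒜, B = ∅ := by
    intro B hB
    have hB' := mem_Uq.1 (h𝒜 hB)
    rw [Finset.eq_empty_iff_forall_notMem]
    intro e he
    have heE : e ∈ M.E := by rw [← coe_gr]; exact_mod_cast hB'.1 he
    have h1 : M.eRk ({e} : Set α) ≤ M.eRk (B : Set α) := M.eRk_mono (by exact_mod_cast Finset.singleton_subset_iff.2 he)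
    rw [hB'.2.1, (hloop e heE).eRk_eq_encard, Set.encard_singleton] at h1
    exact absurd h1 (by decide)
  have hcard : 𝒜.card ≤ 1 := by
    rw [Finset.card_le_one]
    intro a ha b hb
    rw [hU a ha, hU b hb]
  -- two elements of a base give two rank-one sets
  obtain ⟨Bs, hBs⟩ := M.exists_isBase
  have hBcard : Bs.encard = 2 := by rw [hBs.encard_eq_eRank, hM]; rfl
  obtain ⟨e, f, hef, rfl⟩ := Set.encard_eq_two.1 hBcard
  have heE : e ∈ M.E := hBs.subset_ground (by simp)
  have hfE : f ∈ M.E := hBs.subset_ground (by simp)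
  have hone : ∀ x ∈ M.E, ({x} : Finset α) ∈ Yq M 2 0 := by
    intro x hx
    unfold Yq
    rw [Finset.mem_filter, Finset.mem_powerset, Finset.coe_singleton, (hloop x hx).eRk_eq_encard, Set.encard_singleton]
    refine ⟨Finset.singleton_subset_iff.2 (by rw [← Finset.mem_coe, coe_gr]; exact hx), by decide, by decide⟩
  rcases 𝒜.eq_empty_or_nonempty with hemp | hne
  · subst hemp; simp
  · have hmem : (∅ : Finset α) ∈ 𝒜 := by
      obtain ⟨B, hB⟩ := hne
      rw [← hU B hB]; exact hB
    have hsub : ({({e} : Finset α), {f}} : Finset (Finset α)) ⊆ shadow M 2 0 𝒜 := by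
      intro S hS
      rw [Finset.mem_insert, Finset.mem_singleton] at hS
      rw [mem_shadow]
      rcases hS with rfl | rfl
      · exact ⟨hone e heE, ∅, hmem, Finset.empty_subset _⟩
      · exact ⟨hone f hfE, ∅, hmem, Finset.empty_subset _⟩
    have h2 : ({({e} : Finset α), {f}} : Finset (Finset α)).card = 2 := by
      rw [Finset.card_pair]
      intro h
      exact hef (Finset.singleton_inj.1 h)
    have h3 : 2 ≤ (shadow M 2 0 𝒜).card := by
      have := Finset.card_le_card hsub
      rw [h2] at this
      exact this
    rw [phiK_two_zero]
    have h4 : (𝒜.card : ℚ) ≤ 1 := by exact_mod_cast hcard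
    have h5 : (2 : ℚ) ≤ ((shadow M 2 0 𝒜).card : ℚ) := by exact_mod_cast h3
    linarith

/-! ## The induction -/

/-- `Φ(q + 2, q) ≥ 0`. -/
theorem phiK_diag_nonneg (q : ℕ) : 0 ≤ phiK (q + 2) q := by
  rw [GenQ.phiK_succ_succ]; positivity

/-- The core of the induction: a loopless matroid of rank exactly `q + 2`, given the statement at level `q − 1` for
every matroid and at level `q` for every matroid with fewer elements. -/
theorem shadowHall_core (hsel : DirectHullSelection) (q : ℕ)
    (ihq : ∀ q' < q, ∀ (N : Matroid α) [N.Finite], ShadowHall N (q' + 2) q' (phiK (q' + 2) q'))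
    (n : ℕ) (ihn : ∀ n' < n, ∀ (N : Matroid α) [N.Finite], (gr N).card ≤ n' → ShadowHall N (q + 2) q (phiK (q + 2) q))
    (M : Matroid α) [M.Finite] (hn : (gr M).card ≤ n) (hloop : ∀ e ∈ M.E, M.Indep {e})
    (hM : M.eRank = ((q + 2 : ℕ) : ℕ∞)) : ShadowHall M (q + 2) q (phiK (q + 2) q) := by
  rcases Nat.eq_zero_or_pos q with hq0 | hqpos
  · subst hq0
    exact shadowHall_two_zero hloop hM
  obtain ⟨q', rfl⟩ : ∃ q', q = q' + 1 := ⟨q - 1, by omega⟩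
  rw [GenQ.phiK_succ_succ]
  have IHc : ∀ x ∈ M.E, ShadowHall (M ／ ({x} : Set α)) (q' + 1 + 1) (q' + 1 - 1) ((((q' + 1 : ℕ) : ℚ) + 1) / ((q' + 1 : ℕ) : ℚ)) := by
    intro x hx
    have h := ihq q' (by omega) (M ／ ({x} : Set α))
    rw [GenQ.phiK_succ_succ] at h
    have e1 : q' + 1 + 1 = q' + 2 := by omega
    have e2 : q' + 1 - 1 = q' := by omega
    rw [e1, e2]
    convert h using 2 <;> push_cast <;> ring
  have IHd : ∀ x ∈ M.E, ShadowHall (M ＼ ({x} : Set α)) (q' + 1 + 2) (q' + 1) ((((q' + 1 : ℕ) : ℚ) + 2) / (((q' + 1 : ℕ) : ℚ) + 1)) := by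
    intro x hx
    have hxg : x ∈ gr M := by rw [← Finset.mem_coe, coe_gr]; exact hx
    have hcard : (gr (M ＼ ({x} : Set α))).card < n := by
      rw [gr_delete, Finset.card_erase_of_mem hxg]
      have : 0 < (gr M).card := Finset.card_pos.2 ⟨x, hxg⟩
      omega
    have h := ihn _ hcard (M ＼ ({x} : Set α)) le_rfl
    rw [GenQ.phiK_succ_succ] at h
    convert h using 2
  have hstep := shadowHall_step (M := M) (q := q' + 1) (by omega) hM hloop IHc IHd hsel
  convert hstep using 2

/-- **The diagonal shadow form from the selection conjecture**: for every `q` and every finite matroid `M`,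
`ShadowHall M (q + 2) q (Φ(q + 2, q))`, by induction on `(q, #E)` through `shadowHall_step` (loops removed first,
rank truncated to `q + 2`). -/
theorem shadowHall_diag_of_selection (hsel : DirectHullSelection) (q : ℕ) :
    ∀ (n : ℕ) (M : Matroid α) [M.Finite], (gr M).card ≤ n → ShadowHall M (q + 2) q (phiK (q + 2) q) := by
  induction q using Nat.strong_induction_on with
  | _ q ihq =>
    intro n
    induction n using Nat.strong_induction_on with
    | _ n ihn =>
      intro M _ hn
      have ihq' : ∀ q' < q, ∀ (N : Matroid α) [N.Finite], ShadowHall N (q' + 2) q' (phiK (q' + 2) q') :=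
        fun q' hq' N _ => ihq q' hq' (gr N).card N le_rfl
      by_cases hL : ∃ ℓ ∈ M.E, ¬ M.Indep {ℓ}
      · obtain ⟨ℓ, hℓ, hl⟩ := hL
        have hℓg : ℓ ∈ gr M := by rw [← Finset.mem_coe, coe_gr]; exact hℓ
        have hcard : (gr (M ＼ ({ℓ} : Set α))).card < n := by
          rw [gr_delete, Finset.card_erase_of_mem hℓg]
          have : 0 < (gr M).card := Finset.card_pos.2 ⟨ℓ, hℓg⟩
          omega
        exact shadowHall_of_delete_loop hℓ hl (phiK_diag_nonneg q) (ihn _ hcard (M ＼ ({ℓ} : Set α)) le_rfl)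
      · push Not at hL
        rcases lt_trichotomy M.eRank ((q + 2 : ℕ) : ℕ∞) with hlt | heq | hgt
        · exact shadowHall_of_Uq_empty (Uq_eq_empty_of_eRank_lt hlt)
        · exact shadowHall_core hsel q ihq' n ihn M hn hL heq
        · apply shadowHall_of_truncate M (by omega : q < q + 2)
          refine shadowHall_core hsel q ihq' n ihn (PercRepro.Matroid.truncate M (q + 2)) ?_ ?_ ?_
          · rw [gr_truncate]; exact hn
          · exact truncate_loopless M (by omega) hL
          · rw [PercRepro.Matroid.truncate_eRank]
            exact min_eq_right hgt.le

/-- **C-025 at every diagonal `(q + 2, q)` follows from `DirectHullSelection`.** -/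
theorem c025_diag_of_selection (hsel : DirectHullSelection) (q : ℕ) (M : Matroid α) [M.Finite] :
    phiK (q + 2) q * ({A : Set α | A ⊆ M.E ∧ M.eRk A = ((q + 2 : ℕ) : ℕ∞) ∧ M.eRk (M.E \ A) = (q : ℕ∞)}.ncard : ℚ) ≤
      ({A : Set α | A ⊆ M.E ∧ (q : ℕ∞) < M.eRk A ∧ M.eRk A < ((q + 2 : ℕ) : ℕ∞)}.ncard : ℚ) :=
  c025_of_shadowHall (shadowHall_diag_of_selection hsel q (gr M).card M le_rfl)

end PercRepro.Shadow
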